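import Summits.QuantumFields.BalabanUV.InfraRed.StrongCouplingWeightedForestDoor
import Summits.QuantumFields.BalabanUV.InfraRed.StrongCouplingStaggerWeights
import Summits.QuantumFields.BalabanUV.InfraRed.StrongCouplingDoorCeilings
import HarnessLib

/-!
# Strong-coupling front (SC-b): the WEIGHTED forest door — `SU(2)` front at every Wilson `β_W < 5000/18513 = 0.27008…`
(was `4/15 = 0.2667`) — observatory of the non-perturbative crossover; no mass-gap claim

IR-3 v2 TWO-FRONT CROSSOVER LEDGER, front SC (`β₀`), currency **SC-b** = `CrossoverLedger.StrongCouplingFront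
(fundamentalLatticeRep 2) (β₀W/2)` (exponential clustering of every pair of gauge-invariant bounded cylinder observables,
one rate, all large tori, all `0 ≤ β ≤ β₀W/2`; tree coupling = `β_W/2`, `β_W = 4/g²`).
ABSOLUTE RULE of this package: No internally-minted statement may enter as a cited fact. Every hypothesis is either
kernel-proved in this package or a verbatim quotation of a PUBLISHED theorem with page reference. The manuscript(s)
under audit are NOT citable for their own disputed steps — they are the thing under adjudication; programme-internal
(2001/route/tribunal) claims are never citable.  Nothing is cited as a hypothesis: every input is a tree theorem.

## The improvement, honestly

The forest Dobrushin door (`StrongCouplingForestDoor`: F1 staggered forest with row COUNT `15`, F2 forest gauge fixing,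
F3 frozen-forest Dobrushin uniqueness, F4 quarter modulus) opens on `[0, 4/15)` and that ceiling is a theorem
(`StrongCouplingDoorCeilings.su2_forestDoor_iff`).  The Dobrushin criterion only needs the ROW SUMS of the influence
matrix to contract in SOME weighted `ℓ¹` norm (`DobrushinMetricStates`: comparison vector `C e = b(e) κ K₂`): weighing
the time-like links by `t` and the space-like links by `1`, the staggered forest has weighted rows `14 + t` (space-like:
the one possibly dynamic time-like staple link now weighs `t`) and `12/t` (dynamic time-like: twelve unit staple links
against its own weight `t`), so the row constant `15` becomes `ρ(t) = max (14 + t, 12/t)`, optimal `ρ = 7 + √61 = 14.8102…`;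
rational instance `t = 1013/1250`, `ρ = 18513/1250 = 14.8104`.  With the tree's quarter modulus up to `β_W ≤ 2/7`
(`StrongCouplingQuarterModulusTwoSevenths`) the weighted door opens on `[0, 4/ρ) = [0, 5000/18513) = [0, 0.270081…)`:
**SC-b at every `β_W < 5000/18513`** (`su2_strongCouplingFront_lt_twoClass`), instance `β_W = 0.27`
(`su2_strongCouplingFront_027`); and this ceiling is again a theorem (`su2_twoClassDoor_iff`).  Gain over `4/15`: `+1.28 %`.
Finer weight classes (by staggering phase) lower `ρ` further (to `≈ 14.46` with five classes, `≈ 14.14` in the limit,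
i.e. `β_W < 0.2766 … 0.2829`); not done here.

NOT CLAIMED: SC-b at or above `β_W = 5000/18513`; any DLR statement (SC-a stays `β_W < 2/9`); SC-c is `β_W < 2/7` elsewhere;
N ≥ 3; no mass-gap claim.  All (K)-grade: kernel theorems over Mathlib's Haar measure, hypothesis-free.
-/

noncomputable section

open Literature.MathematicalPhysics.QuantumFieldTheory
open Literature.MathematicalPhysics.QuantumLattice (fundamentalRep fundamentalLatticeRep)
open Literature.MathematicalPhysics.QuantumFieldTheory.Balaban1983to89
open Literature.MathematicalPhysics.QuantumFieldTheory.Balaban1983to89.StrongCouplingDobrushinWindow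
open Summit.QuantumFields.BalabanUV.InfraRed.StrongCouplingForestGauge
open Summit.QuantumFields.BalabanUV.InfraRed.StrongCouplingStaggerForest
open Summit.QuantumFields.BalabanUV.InfraRed.StrongCouplingWeightedFrozenCovariance (WeightedForestRowBound)
open Summit.QuantumFields.BalabanUV.InfraRed.StrongCouplingWeightedForestDoor (su2_weightedForestDoor)
open Summit.QuantumFields.BalabanUV.InfraRed.StrongCouplingStaggerWeights
open Summit.QuantumFields.BalabanUV.InfraRed.StrongCouplingQuarterModulusTwoSevenths (oneLinkKRModulusSU2_of_le_twoSevenths)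
open Summit.QuantumFields.BalabanUV.InfraRed.StrongCouplingDoorCeilings (door_iff)

namespace Summit.QuantumFields.BalabanUV.InfraRed.StrongCouplingWeightedFront

/-- **W4 as a `WeightedForestRowBound`** (`L ≥ 4`, `0 ≤ t ≤ 1`, `14 + t ≤ ρ`, `12 ≤ ρ t`). [folklore] -/
theorem weightedForestRowBound_stagger {L : ℕ} [NeZero L] (hL : 4 ≤ L) {t ρ : ℝ} (ht0 : 0 ≤ t) (ht1 : t ≤ 1)
    (hρS : 14 + t ≤ ρ) (hρT : 12 ≤ ρ * t) : WeightedForestRowBound (staggerForest L) (stagWeight t) ρ :=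
  fun e he => weightedRow_stagger_le hL ht0 ht1 hρS hρT e he

/-- **The two-class weighted forest door** (`SU(2)`): for `0 < t ≤ 1`, `14 + t ≤ ρ`, `12 ≤ ρ t`, every
`0 ≤ β₀W ≤ 2/7` with `ρ β₀W (1/4) < 1` carries the strong-coupling front (SC-b) — staggered forests with two-class
weights (W4), the proved gauge fixing and weighted frozen clustering (W3b), the quarter modulus up to `2/7`. [folklore] -/
theorem su2_strongCouplingFront_of_twoClass {t ρ β₀W : ℝ} (ht0 : 0 < t) (ht1 : t ≤ 1) (hρS : 14 + t ≤ ρ)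
    (hρT : 12 ≤ ρ * t) (h27 : β₀W ≤ 2 / 7) (hsmall : ρ * β₀W * (1 / 4) < 1) :
    CrossoverLedger.StrongCouplingFront (fundamentalLatticeRep 2) (β₀W / 2) :=
  su2_weightedForestDoor (ρ := ρ) (vmin := t) (vmax := 1) (by linarith) ht0 (by norm_num)
    (fun S => staggerForest (2 * S + 1)) (fun _ => stagRank) (fun _ => stagWeight t) 2
    (fun S hS => ⟨isRankedForest_stagger (by omega), weightedForestRowBound_stagger (by omega) ht0.le ht1 hρS hρT,
      fun y => (stagWeight_mem ht0.le ht1 y).1, fun y => (stagWeight_mem ht0.le ht1 y).2.1⟩)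
    (oneLinkKRModulusSU2_of_le_twoSevenths h27) hsmall

/-- **SC-b BELOW `5000/18513 = 0.27008…`, HYPOTHESIS-FREE** (was `4/15 = 0.2667`): the `SU(2)` strong-coupling front at
every Wilson `β₀W < 5000/18513` (tree coupling `β₀W/2 < 2500/18513`; vacuous for `β₀W < 0`), through the two-class weighted forest door at
`t = 1013/1250`, `ρ = 18513/1250`. [folklore] -/
theorem su2_strongCouplingFront_lt_twoClass {β₀W : ℝ} (hlt : β₀W < 5000 / 18513) :
    CrossoverLedger.StrongCouplingFront (fundamentalLatticeRep 2) (β₀W / 2) :=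
  su2_strongCouplingFront_of_twoClass (t := 1013 / 1250) (ρ := 18513 / 1250) (by norm_num) (by norm_num)
    (by norm_num) (by norm_num) (by linarith) (by linarith)

/-- Instance: **SC-b AT Wilson `β_W = 0.27`** (tree coupling `0.135`; `0.27 < 5000/18513`). [folklore] -/
theorem su2_strongCouplingFront_027 :
    CrossoverLedger.StrongCouplingFront (fundamentalLatticeRep 2) ((27 / 100 : ℝ) / 2) :=
  su2_strongCouplingFront_lt_twoClass (by norm_num)

/-- SC-b in the bare coupling: every `g² > 18513/1250 = 14.8104` (`β_W = 4/g² < 5000/18513`) carries the `SU(2)`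
strong-coupling front (was `g² > 15`). [folklore] -/
theorem su2_strongCouplingFront_of_bareCoupling {gsq : ℝ} (hg : 18513 / 1250 < gsq) :
    CrossoverLedger.StrongCouplingFront (fundamentalLatticeRep 2) ((4 / gsq) / 2) := by
  have hg0 : 0 < gsq := lt_trans (by norm_num) hg
  refine su2_strongCouplingFront_lt_twoClass ?_
  rw [div_lt_iff₀ hg0]
  linarith

/-- **The two-class door's ceiling is a theorem**: with the quarter modulus below `2/7` the two-class door at
`ρ = 18513/1250` opens (some admissible `K₂`) exactly on `[0, 5000/18513)`. [folklore] -/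
theorem su2_twoClassDoor_iff {βW : ℝ} (h0 : 0 ≤ βW) :
    (∃ K₂ : ℝ, 0 ≤ K₂ ∧ OneLinkKRModulusSU2 βW K₂ ∧ 18513 / 1250 * βW * K₂ < 1) ↔ βW < 5000 / 18513 := by
  have h := door_iff (D := 18513 / 1250) (by norm_num)
    (fun b _ hb => oneLinkKRModulusSU2_of_le_twoSevenths (by rw [div_div_eq_mul_div] at hb; linarith)) h0
  rw [h, div_div_eq_mul_div]
  norm_num

/-- The numbers side by side: `2/9 < 4/15 < 0.27 < 5000/18513 < 2/7`, and `5000/18513 = 4/(18513/1250)`. [folklore] -/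
theorem twoClass_window_numbers :
    (2 : ℝ) / 9 < 4 / 15 ∧ (4 : ℝ) / 15 < 27 / 100 ∧ (27 : ℝ) / 100 < 5000 / 18513 ∧ (5000 : ℝ) / 18513 < 2 / 7 ∧
      (5000 : ℝ) / 18513 = 4 / (18513 / 1250) := by
  norm_num

end Summit.QuantumFields.BalabanUV.InfraRed.StrongCouplingWeightedFront
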